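/- Lead `ym-line-cbag-p1` (prover-ym-line-cbag-p1-g0-0), route `ColdBoxAllGroups`, crux `BoxFloorAllGroups` (stmt-QuantumFields-22254). -/
import Summits.QuantumFields.YangMills.Theses.ColdBoxAllGroups
import Summits.QuantumFields.YangMills.Theorems.WeakCouplingRatesColdBoxTwoPointFloorWStubBoxKernelVsLattice
import Summits.QuantumFields.YangMills.Theorems.WeakCouplingRatesColdBoxTwoPointFloorStubBoxGaussianWick
import Summits.QuantumFields.YangMills.Theorems.BalabanLadderNTOnePointFloor
import Summits.QuantumFields.YangMills.Theorems.ColdBoxAllGroupsBoxFloorAllGroupsStubBoxGaussianDominationGOfAbs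
import Summits.QuantumFields.YangMills.Theorems.ColdBoxAllGroupsBoxFloorAllGroupsStubBoxDirichletDominationAbsG

/-!
# Crux `BoxFloorAllGroups` (stmt-QuantumFields-22254) of route `ColdBoxAllGroups` — PROVED (every compact simple `G`)

`BoxFloorAllGroups_proof : Summit.QuantumFields.YangMills.Theses.ColdBoxAllGroups.BoxFloorAllGroups` — for every compact simple `G` (tree
sense `IsCompactSimpleLieGroup`) and every faithful unitary lattice representation `r` there is a box-exponent ceiling `θ₀ > 0` (`= 1/100`)
such that for all `0 < A < θ ≤ θ₀` some `c > 0` satisfies `BoxTwoPointDomination r.ρ A θ c`: for all large `β` the connected covariance of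
the two central `(1,2)`-plaquette costs `N − Re tr r(U_p)` at time separation `⌈β^A⌉` in the cold-wall Wilson box of side `2⌈β^θ⌉+1` obeys
`β²·Cov ≥ c·C(⌈β^A⌉)²`.

This is the kernel-checked composition of the registered skeleton (line `birth`, v5, `Cruxes/BoxFloorAllGroups/Lines/birth.lean`) with its
stubs replaced by the tree theorems that landed them BY NAME (width seats w2, w3 of the line and the lead):
* S2 `stub_boxDirichletDominationAbsG` (the one-scale Laplace expansion of the cold-wall box in the temporal-forest gauge and the exponential
  chart, `D = dimE r.ρ` colours; bricks LargeFieldG/LinkSmallG/CubicG/GoodReductionG/RepresentationG{,GaussG,GBall}/ChartWindowG (w3),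
  ExpChartPackage2{AB,Haar}/ChartDensityJ (w2), OneScaleDefs/GaussSideD/TiltBoundG/GaussTailD/CoreG/ExponentsG/assembly (lead));
* S3 `stub_boxGaussianDominationG_of_abs` (absolute Dirichlet form ⇒ relative free form, precision `∝ 1/(D+1)`);
* `dimE_pos_of_isCompactSimpleLieGroup` (`D ≥ 1`), S3a `stub_boxGaussianWick`, S4 `stub_boxKernelVsLattice` (group-free, route
  `WeakCouplingRates`).  `c = c₁²/4` with `c₁` from S4.
No sorry, no hypothesis, standard axioms.  NOT the Yang–Mills mass gap: a finite-volume weak-coupling covariance floor for one Wilson box, the BOX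
half of a RECORD-label rung (R2xi-G `XiPow`) strictly below the Clay statement; BULK_G is the separate crux stmt-QuantumFields-22255.
-/

set_option autoImplicit false

noncomputable section

namespace Summit.QuantumFields.YangMills.Theorems.ColdBoxAllGroups

open MeasureTheory
open Literature.MathematicalPhysics.QuantumFieldTheory Literature.MathematicalPhysics.QuantumLattice
open Summit.QuantumFields.YangMills.Theorems.WeakCouplingRates
open Summit.QuantumFields.YangMills.Theorems.FreeEnergyLogCoefficient (dimE)

/-- **The relative Gaussian domination, every compact simple `G`** (S3 ∘ S2 ∘ S1): there is `θ₀ > 0` such that for all `0 < A < θ ≤ θ₀`,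
eventually in `β`, `|β²·boxPlaqCov r.ρ β ⌈β^θ⌉ ⌈β^A⌉ − (D/4)·boxCircSqCov| ≤ (1/8)·boxCircSqCov`. -/
theorem boxGaussianDominationG :
    ∀ (G : Type) [Group G] [TopologicalSpace G] [IsTopologicalGroup G] [CompactSpace G],
    IsCompactSimpleLieGroup G →
    letI : MeasurableSpace G := borel G
    haveI : BorelSpace G := ⟨rfl⟩
    ∀ r : LatticeRep G, ∃ θ₀ : ℝ, 0 < θ₀ ∧ ∀ A θ : ℝ, 0 < A → A < θ → θ ≤ θ₀ → ∃ β₀ : ℝ, ∀ β : ℝ, β₀ ≤ β →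
      |β ^ 2 * boxPlaqCov r.ρ β ⌈β ^ θ⌉₊ ⌈β ^ A⌉₊ - (dimE r.ρ : ℝ) / 4 * boxCircSqCov ⌈β ^ θ⌉₊ ⌈β ^ A⌉₊| ≤
        1 / 8 * boxCircSqCov ⌈β ^ θ⌉₊ ⌈β ^ A⌉₊ :=
  stub_boxGaussianDominationG_of_abs (stub_boxDirichletDominationAbsG stub_boxLargeFieldRarityG)

/-- **Crux `BoxFloorAllGroups` of route `ColdBoxAllGroups`, PROVED** — from `1 ≤ D` and the relative Gaussian domination: the crux BY NAME,
with `c = c₁²/4` (`c₁` from S4 `stub_boxKernelVsLattice`), via S3a `stub_boxGaussianWick` (`boxCircSqCov = 2·boxMaxwellPlaqCov²`):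
`β²Cov ≥ (D/4 − 1/8)·2Π² ≥ Π²/4 ≥ (c₁²/4)·C(T)²`. -/
theorem BoxFloorAllGroups_proof : Summit.QuantumFields.YangMills.Theses.ColdBoxAllGroups.BoxFloorAllGroups := by
  intro G _ _ _ _ hG
  letI : MeasurableSpace G := borel G
  haveI : BorelSpace G := ⟨rfl⟩
  intro r
  obtain ⟨θ₀, hθ₀, hwin⟩ := boxGaussianDominationG G hG r
  have hD : (1 : ℝ) ≤ (dimE r.ρ : ℝ) := by
    exact_mod_cast Nat.succ_le_of_lt (Summit.QuantumFields.YangMills.Cruxes.NT.LinkEquipartition.dimE_pos_of_isCompactSimpleLieGroup G r hG)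
  refine ⟨θ₀, hθ₀, fun A θ hA hAθ hθ => ?_⟩
  obtain ⟨β₀, h₀⟩ := hwin A θ hA hAθ hθ
  obtain ⟨c₁, hc₁, β₁, h₁⟩ := stub_boxKernelVsLattice A θ hA hAθ
  refine ⟨c₁ ^ 2 / 4, by positivity, max β₀ β₁, fun β hβ => ?_⟩
  have h0 := (abs_le.1 (h₀ β (le_trans (le_max_left _ _) hβ))).1
  have h1 := h₁ β (le_trans (le_max_right _ _) hβ)
  have hW := stub_boxGaussianWick ⌈β ^ θ⌉₊ ⌈β ^ A⌉₊
  set P := boxMaxwellPlaqCov ⌈β ^ θ⌉₊ ⌈β ^ A⌉₊ with hP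
  set S := boxCircSqCov ⌈β ^ θ⌉₊ ⌈β ^ A⌉₊ with hS
  have hS2 : S = 2 * P ^ 2 := hW
  have hPsq : 0 ≤ P ^ 2 := sq_nonneg _
  have h1' : (c₁ * |curvaturePlaquetteCorr (d := 4) (by norm_num) (⌈β ^ A⌉₊ : ℤ)|) ^ 2 ≤ |P| ^ 2 :=
    pow_le_pow_left₀ (by positivity) h1 2
  rw [sq_abs, mul_pow, sq_abs] at h1'
  have hmain : (1 / 4 : ℝ) * P ^ 2 ≤ β ^ 2 * boxPlaqCov r.ρ β ⌈β ^ θ⌉₊ ⌈β ^ A⌉₊ := by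
    have : ((dimE r.ρ : ℝ) / 4 - 1 / 8) * S ≤ β ^ 2 * boxPlaqCov r.ρ β ⌈β ^ θ⌉₊ ⌈β ^ A⌉₊ := by linarith
    rw [hS2] at this
    nlinarith
  calc c₁ ^ 2 / 4 * curvaturePlaquetteCorr (d := 4) (by norm_num) (⌈β ^ A⌉₊ : ℤ) ^ 2
      = (1 / 4 : ℝ) * (c₁ ^ 2 * curvaturePlaquetteCorr (d := 4) (by norm_num) (⌈β ^ A⌉₊ : ℤ) ^ 2) := by ring
    _ ≤ (1 / 4 : ℝ) * P ^ 2 := by gcongr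
    _ ≤ _ := hmain

end Summit.QuantumFields.YangMills.Theorems.ColdBoxAllGroups

end
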